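import Summits.ValiantsHypothesis.ValiantsHypothesis.Theses.BarrierLever
import Summits.ValiantsHypothesis.ValiantsHypothesis.Theorems.BarrierLeverPartitionMinorsHitByVPExactCoverNoGo

/-!
# Route BarrierLever — item `ExactCoverCertificatesExist` (stmt-ValiantsHypothesis-21429) is FALSE

Refutation file (cell valiant-natproofs, rung V4, 𝒟-side door (e); prover seat val-np-p5 gen 27).
The route decl `ExactCoverCertificatesExist` («for every `h ≥ 2` and every injective LOWER layout pair
`(u, w)` over `[h]` some list of `L ≤ (h+h)^3` weighted bricks `1 + ε x^Z y^W` has a nonsingular layout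
matrix») is, verbatim, the hypothesis refuted by
`ExactCoverNoGo.not_exactCoverHypothesis_lowerSets` (val-np-p1 gen 14, p570824): the Reed–Solomon layout
at `h = 127² = 16129` (rows: the cubes over the `127⁷` graphs of polynomials of degree `< 7` over
`𝔽₁₂₇`; columns: a lower family of the same size inside the Hamming ball of radius `21`) forces
`≥ 127⁷ > (2h)^3` bricks. This file only restates that theorem at the route decl's name so that the
ledger item closes `refuted`.

CLASS: refuted-substantive — the same construction with `d ≈ ½ log₂ q` forces `2^{Ω(log² h)}` bricks,
so no polynomial bound `(h+h)^c` repairs the statement; a repaired statement with exponentially many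
bricks would no longer be a poly-size certificate (the point of door (e)). Item 19717
`PartitionMinorsHitByVP` is untouched (its witnesses need not be brick products).

WHAT THIS IS NOT: nothing on crux stmt-ValiantsHypothesis-14610, on 8745/8749, or on `VP ≠ VNP`.
-/

-- layout Summits/ValiantsHypothesis/ValiantsHypothesis forces the duplicated namespace component
set_option linter.dupNamespace false

namespace Summit.ValiantsHypothesis.ValiantsHypothesis.Theorems.BarrierLever.ExactCoverNoGo

/-- **Item stmt-ValiantsHypothesis-21429 refuted (class: refuted-substantive).** The route statement
`ExactCoverCertificatesExist` is false: witness the Reed–Solomon lower layout pair at `h = 16129`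
(`q = 127`, `d = 7`, column radius `K = 21`) of `not_exactCoverHypothesis_lowerSets`, which admits no
nonsingular brick-product layout matrix with `≤ (h+h)^3` bricks. No cheap repair: the brick count is
`2^{Ω(log² h)}` along the family `d ≈ ½ log₂ q`, beating every polynomial bound. [folklore] -/
theorem not_ExactCoverCertificatesExist :
    ¬ Summit.ValiantsHypothesis.ValiantsHypothesis.Theses.BarrierLever.ExactCoverCertificatesExist :=
  not_exactCoverHypothesis_lowerSets

end Summit.ValiantsHypothesis.ValiantsHypothesis.Theorems.BarrierLever.ExactCoverNoGo
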